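import Summits.QuantumFields.YangMills.Theses.RenyiTelescope

/-!
# Route `RenyiTelescope` — crux `CutoffRenyiL` (stmt-QuantumFields-27137), registered stub `stub_holderEvent` (M), PROVED:
# the Rényi-moment / Hölder change of measure in EVENT form

The BC3 birth skeleton of crux `CutoffRenyiL` (LINE 6 of ideator seat ym-r3-idea-2 g3, registered on stmt-QuantumFields-27137) composes the
crux from `stub_renyiMomentBound` (XL — the analytic content: a bound on the order-`q` Rényi moment of the interior-conditioned unit law of
cut-off `J+1` relative to that of cut-off `J` at the CLT scale; NOT touched here) and `stub_holderEvent` (M).  THIS FILE proves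

* §1 the ABSTRACT lemma (`measureReal_le_renyiMoment_rpow_mul`): finite measures `μ, ν` on any measurable space, `ν ≪ μ`, `1 < q`, and
  `(dν/dμ)^q` `μ`-integrable (as a real function, via `ENNReal.toReal`) ⇒ for every measurable `A`,
  `ν(A) ≤ (∫ (dν/dμ)^q dμ)^(1/q) · μ(A)^(1 − 1/q)` — Hölder (Mathlib `integral_mul_le_Lp_mul_Lq_of_nonneg`, exponents `q` and `q/(q−1)`)
  applied to `dν/dμ · 1` under `μ|A`, with `ν(A) = ∫_A dν/dμ dμ` (`Measure.setIntegral_toReal_rnDeriv`);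
* §2 the stub's shape for the skeleton's objects with `condUnitLaw`/`renyiMoment` UNFOLDED (`holderEvent_map_unitA_restrict`: push-forwards under
  `unitA` of restricted Gibbs laws, finite since `gibbsK` is a probability measure for `γ ≥ 0`) — the registered `stub_holderEvent` is this theorem at
  `J' = J+1`, `S = Int_J`, `S' = Int_{J+1}` and §3 restates the skeleton's two `def`s VERBATIM and proves `stub_holderEvent` BY NAME AND SIGNATURE from it (one line).

HONEST SCOPE.  `stub_renyiMomentBound`, the crux `CutoffRenyiL`, the route and rung R3 (leaf `YM3TorusSU2`) stay open; nothing here bears on the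
Yang–Mills mass gap.  [folklore: Hölder's inequality / Rényi-divergence change of measure, e.g. van Erven–Harremoës, IEEE T-IT 60 (2014) Thm 8]
-/

noncomputable section

open MeasureTheory
open Literature.MathematicalPhysics.QuantumFieldTheory.Balaban1983to89
open Literature.MathematicalPhysics.QuantumFieldTheory.Balaban1983to89.T3ContinuumYM3Torus

namespace Summit.QuantumFields.YangMills.Theorems.RenyiTelescope

/-! ## §1 The abstract Hölder change of measure -/

/-- **RÉNYI-MOMENT CHANGE OF MEASURE IN EVENT FORM.**  `μ, ν` finite, `ν ≪ μ`, `1 < q`, `(dν/dμ)^q` integrable w.r.t. `μ` ⇒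
`ν(A) ≤ (∫ (dν/dμ)^q dμ)^(1/q) · μ(A)^(1 − 1/q)` for measurable `A`. [folklore: Hölder] -/
theorem measureReal_le_renyiMoment_rpow_mul {Ω : Type*} [MeasurableSpace Ω] (μ ν : Measure Ω) [IsFiniteMeasure μ] [IsFiniteMeasure ν]
    {q : ℝ} (hq : 1 < q) (hac : ν.AbsolutelyContinuous μ)
    (hint : Integrable (fun x => ((ν.rnDeriv μ x).toReal) ^ q) μ) (A : Set Ω) :
    ν.real A ≤ (∫ x, ((ν.rnDeriv μ x).toReal) ^ q ∂μ) ^ (1 / q) * (μ.real A) ^ (1 - 1 / q) := by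
  set g : Ω → ℝ := fun x => (ν.rnDeriv μ x).toReal with hg
  have hg0 : ∀ x, 0 ≤ g x := fun x => ENNReal.toReal_nonneg
  have hgm : AEStronglyMeasurable g μ := (Measure.measurable_rnDeriv ν μ).ennreal_toReal.aestronglyMeasurable
  have hq0 : 0 < q := zero_lt_one.trans hq
  have hq1 : 0 < q - 1 := sub_pos.mpr hq
  -- conjugate exponents `q` and `q' = q/(q-1)`, `1/q' = 1 - 1/q`
  have hpq : q.HolderConjugate (Real.conjExponent q) := Real.HolderConjugate.conjExponent hq
  have hq' : 1 / Real.conjExponent q = 1 - 1 / q := by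
    unfold Real.conjExponent
    field_simp
  -- `g ∈ L^q(μ)` from the integrability of `g^q`
  have hgLp : MemLp g (ENNReal.ofReal q) μ := by
    have hiff := integrable_norm_rpow_iff (μ := μ) hgm (p := ENNReal.ofReal q)
      (by simp [hq0]) ENNReal.ofReal_ne_top
    rw [ENNReal.toReal_ofReal hq0.le] at hiff
    refine hiff.mp ?_
    refine hint.congr (Filter.Eventually.of_forall fun x => ?_)
    simp only [hg, Real.norm_of_nonneg ENNReal.toReal_nonneg]
  -- Hölder under `μ|A` for `g · 1`
  have hH := integral_mul_le_Lp_mul_Lq_of_nonneg (μ := μ.restrict A) hpq (f := g) (g := fun _ => (1 : ℝ))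
    (Filter.Eventually.of_forall hg0) (Filter.Eventually.of_forall fun _ => zero_le_one)
    (hgLp.restrict A) (memLp_const 1)
  -- the pieces
  have hνA : ν.real A = ∫ x in A, g x ∂μ := (Measure.setIntegral_toReal_rnDeriv hac A).symm
  have h1 : ∫ x in A, g x * (1 : ℝ) ∂μ = ∫ x in A, g x ∂μ := by simp
  have h2 : ∫ _x in A, (1 : ℝ) ^ Real.conjExponent q ∂μ = μ.real A := by
    simp [Real.one_rpow]
  have h3 : ∫ x in A, g x ^ q ∂μ ≤ ∫ x, g x ^ q ∂μ :=
    setIntegral_le_integral hint (Filter.Eventually.of_forall fun x => Real.rpow_nonneg (hg0 x) q)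
  have h3' : (∫ x in A, g x ^ q ∂μ) ^ (1 / q) ≤ (∫ x, g x ^ q ∂μ) ^ (1 / q) :=
    Real.rpow_le_rpow (integral_nonneg fun x => Real.rpow_nonneg (hg0 x) q) h3 (by positivity)
  rw [h1, h2, hq'] at hH
  rw [hνA]
  refine hH.trans ?_
  exact mul_le_mul_of_nonneg_right h3' (Real.rpow_nonneg measureReal_nonneg _)

/-! ## §2 Instantiation recipe for the registered stub

The skeleton's `condUnitLaw F L γ b₀ p₀ c J := Measure.map (unitA F ℰp J) ((gibbsK F ℰp γ J).restrict Int_J)` is a finite measure for `γ ≥ 0`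
(`isFiniteMeasure_map_unitA_restrict` below), and `renyiMoment F L γ b₀ p₀ c J q` is literally `∫ V, ((condUnitLaw … (J+1)).rnDeriv (condUnitLaw … J) V).toReal ^ q
∂(condUnitLaw … J)`; hence the registered `stub_holderEvent` is, after `intro F L γ b₀ p₀ c J q hγ hq hac hint A _`, exactly
`measureReal_le_renyiMoment_rpow_mul (condUnitLaw … J) (condUnitLaw … (J+1)) hq hac hint A` with the two finiteness instances supplied by the lemma
below — carried out in §3. -/

/-- The push-forward under `unitA` of a restricted Gibbs law is a finite measure (`γ ≥ 0`). -/
theorem isFiniteMeasure_map_unitA_restrict (F : T3Family) {γ : ℝ} (hγ : 0 ≤ γ) (J : ℕ)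
    (S : Set (GaugeField (F.P J) 0 (Matrix.specialUnitaryGroup (Fin 2) ℂ))) :
    IsFiniteMeasure (Measure.map (T3UnitScaleTilt.unitA F T3UnitLawDensityEML.ℰp J)
      ((T3UnitScaleTilt.gibbsK F T3UnitLawDensityEML.ℰp γ J).restrict S)) := by
  haveI := T3UnitScaleTilt.isProbabilityMeasure_gibbsK F T3UnitLawDensityEML.ℰp hγ J
  infer_instance

/-- **The registered stub's shape, for ANY pair of restricted-and-pushed-forward Gibbs laws** (cut-offs `J`, `J'`, restriction sets `S`, `S'`):
this is `stub_holderEvent` with the skeleton's `condUnitLaw`/`renyiMoment` unfolded (take `J' = J+1`, `S = Int_J`, `S' = Int_{J+1}`). [folklore: Hölder] -/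
theorem holderEvent_map_unitA_restrict (F : T3Family) {γ : ℝ} (hγ : 0 < γ) (J J' : ℕ)
    (S : Set (GaugeField (F.P J) 0 (Matrix.specialUnitaryGroup (Fin 2) ℂ)))
    (S' : Set (GaugeField (F.P J') 0 (Matrix.specialUnitaryGroup (Fin 2) ℂ))) {q : ℝ} (hq : 1 < q)
    (hac : (Measure.map (T3UnitScaleTilt.unitA F T3UnitLawDensityEML.ℰp J')
        ((T3UnitScaleTilt.gibbsK F T3UnitLawDensityEML.ℰp γ J').restrict S')).AbsolutelyContinuous
      (Measure.map (T3UnitScaleTilt.unitA F T3UnitLawDensityEML.ℰp J)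
        ((T3UnitScaleTilt.gibbsK F T3UnitLawDensityEML.ℰp γ J).restrict S)))
    (hint : Integrable (fun V => (((Measure.map (T3UnitScaleTilt.unitA F T3UnitLawDensityEML.ℰp J')
        ((T3UnitScaleTilt.gibbsK F T3UnitLawDensityEML.ℰp γ J').restrict S')).rnDeriv
      (Measure.map (T3UnitScaleTilt.unitA F T3UnitLawDensityEML.ℰp J)
        ((T3UnitScaleTilt.gibbsK F T3UnitLawDensityEML.ℰp γ J).restrict S)) V).toReal) ^ q)
      (Measure.map (T3UnitScaleTilt.unitA F T3UnitLawDensityEML.ℰp J)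
        ((T3UnitScaleTilt.gibbsK F T3UnitLawDensityEML.ℰp γ J).restrict S)))
    (A : Set (GaugeField (F.P 0) 0 (Matrix.specialUnitaryGroup (Fin 2) ℂ))) :
    (Measure.map (T3UnitScaleTilt.unitA F T3UnitLawDensityEML.ℰp J')
        ((T3UnitScaleTilt.gibbsK F T3UnitLawDensityEML.ℰp γ J').restrict S')).real A ≤
      (∫ V, (((Measure.map (T3UnitScaleTilt.unitA F T3UnitLawDensityEML.ℰp J')
          ((T3UnitScaleTilt.gibbsK F T3UnitLawDensityEML.ℰp γ J').restrict S')).rnDeriv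
        (Measure.map (T3UnitScaleTilt.unitA F T3UnitLawDensityEML.ℰp J)
          ((T3UnitScaleTilt.gibbsK F T3UnitLawDensityEML.ℰp γ J).restrict S)) V).toReal) ^ q
        ∂(Measure.map (T3UnitScaleTilt.unitA F T3UnitLawDensityEML.ℰp J)
          ((T3UnitScaleTilt.gibbsK F T3UnitLawDensityEML.ℰp γ J).restrict S))) ^ (1 / q) *
      ((Measure.map (T3UnitScaleTilt.unitA F T3UnitLawDensityEML.ℰp J)
          ((T3UnitScaleTilt.gibbsK F T3UnitLawDensityEML.ℰp γ J).restrict S)).real A) ^ (1 - 1 / q) := by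
  haveI := isFiniteMeasure_map_unitA_restrict F hγ.le J S
  haveI := isFiniteMeasure_map_unitA_restrict F hγ.le J' S'
  exact measureReal_le_renyiMoment_rpow_mul _ _ hq hac hint A

/-! ## §3 The skeleton's two objects (verbatim from the registered skeleton) and the stub BY NAME AND SIGNATURE -/

/-- The interior-conditioned unit-scale law at cut-off `J` (unnormalised). -/
def condUnitLaw (F : T3Family) (L : ℕ) (γ b₀ p₀ c : ℝ) (J : ℕ) :
    Measure (GaugeField (F.P 0) 0 (Matrix.specialUnitaryGroup (Fin 2) ℂ)) :=
  Measure.map (T3UnitScaleTilt.unitA F T3UnitLawDensityEML.ℰp J)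
    ((T3UnitScaleTilt.gibbsK F T3UnitLawDensityEML.ℰp γ J).restrict
      (T3InteriorExcision.histGoodInt F (T3UnitScaleTilt.θBal L γ b₀ p₀) (T3UnitScaleTilt.θBal L γ (c * b₀) p₀ 1) J 1))

/-- The order-`q` Rényi moment of the cut-off-`(J+1)` conditioned unit law relative to the cut-off-`J` one. -/
def renyiMoment (F : T3Family) (L : ℕ) (γ b₀ p₀ c : ℝ) (J : ℕ) (q : ℝ) : ℝ :=
  ∫ V, (((condUnitLaw F L γ b₀ p₀ c (J + 1)).rnDeriv (condUnitLaw F L γ b₀ p₀ c J) V).toReal) ^ q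
    ∂(condUnitLaw F L γ b₀ p₀ c J)

/-- **STUB `stub_holderEvent` of crux `CutoffRenyiL` (stmt-QuantumFields-27137), exactly as registered.** [folklore: Hölder] -/
theorem stub_holderEvent : open Literature.MathematicalPhysics.QuantumFieldTheory.Balaban1983to89 Literature.MathematicalPhysics.QuantumFieldTheory.Balaban1983to89.T3ContinuumYM3Torus in ∀ (F : T3Family) (L : ℕ) (γ b₀ p₀ c : ℝ) (J : ℕ) (q : ℝ), 0 < γ → 1 < q →
      (condUnitLaw F L γ b₀ p₀ c (J + 1)).AbsolutelyContinuous (condUnitLaw F L γ b₀ p₀ c J) →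
      MeasureTheory.Integrable
        (fun V => (((condUnitLaw F L γ b₀ p₀ c (J + 1)).rnDeriv (condUnitLaw F L γ b₀ p₀ c J) V).toReal) ^ q)
        (condUnitLaw F L γ b₀ p₀ c J) →
      ∀ (A : Set (GaugeField (F.P 0) 0 (Matrix.specialUnitaryGroup (Fin 2) ℂ))), MeasurableSet A →
        (condUnitLaw F L γ b₀ p₀ c (J + 1)).real A ≤
          (renyiMoment F L γ b₀ p₀ c J q) ^ (1 / q) * ((condUnitLaw F L γ b₀ p₀ c J).real A) ^ (1 - 1 / q) := by
  intro F L γ b₀ p₀ c J q hγ hq hac hint A _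
  exact holderEvent_map_unitA_restrict F hγ J (J + 1) _ _ hq hac hint A

end Summit.QuantumFields.YangMills.Theorems.RenyiTelescope

end
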